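import Summits.Ventures.CertifiedQuantumChemistry.Rows.DifferencePencilRows
import Summits.Ventures.CertifiedQuantumChemistry.Rows.OrbitalRelabelling
import HarnessLib

/-!
# Ventures/CertifiedQuantumChemistry — Rows/DifferencePencilAlignedRows.lean: difference rows do not
# see the ORBITAL ORDER of either file; `dE-direct:d` certificates issued on an orbital-ALIGNED parent
# `P(F_A)` (lead ruling R-A6) prove the difference rows of the pinned pair `(F_A, F_B)` itself

HONEST FRAMING (verbatim): certified bounds for a stated model Hamiltonian in a stated basis; not a
claim about the real molecule or material beyond that model.

Typer chem-type-09 (LADDER-CHEM I-TYPE slot 09; glue only — theorems, no definition, nothing asserted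
about any file). chem-solver-4's pencil files are `K⁺_μ = (1 + μ)·P(F_A) − F_B`, `K⁻_ν = (1 + ν)·F_B −
P(F_A)` with `P` an irrep-aligning ORBITAL PERMUTATION of `F_A` (chem-lead IDIFF-SHAPE-A R-A6: «optional
exact-orthogonal … orbital alignment of `F_B` before combining — validity never depends on it»; STATUS
2026-08-26T17:34:07Z). The certified QUANTITY is order-independent (`Rows/OrbitalRelabelling.lean`,
`Model.energy_eq_of_perm`: `E₀(H_{P(F)}; a, b) = E₀(H_F; a, b)`), so:

* §1 `diffLowerRow_iff_of_perm_left/right`, `diffUpperRow_iff_of_perm_left/right`,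
  `diffBracket_iff_of_perm_left/right` — the difference rows of `Rows/DifferenceRows.lean` for a
  reordered parent and for the original parent are EQUIVALENT (either slot).
* §2 `diffLowerRow_of_alignedPencil_certificates`, `diffUpperRow_of_alignedPencil_certificates`,
  `diffBracket_of_alignedPencils` — the `dE-direct:d` soundness theorems of
  `Rows/DifferencePencilRows.lean` with the combined file built from the ALIGNED parent
  `F_A′ = P(F_A)` (hypotheses `hh`, `heri`, `hcore` relating `F_A′` to `F_A` through `π`, exactly as
  in `Rows/OrbitalRelabelling.lean`; no `Model.reindex` definition) and the upper certificate of
  either order, concluding the rows of the PINNED pair `(F_A, F_B)`: the only per-instance datum is the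
  permutation `π`, which the lincomb COMBO record prints.

What is NOT here: general orbital ROTATIONS (an exact-orthogonal rational Cayley alignment is a
unitary change of one-particle basis; `E₀` is invariant under it too — `Rows/OrbitalRotationInvariance`
— but the combined tables then are not a lincomb of the two pinned files' literal tables and need their
own pin); any statement about which permutation a given run used (reader data).
-/

noncomputable section

namespace Summit.Ventures.CertifiedQuantumChemistry

open Matrix

/-! ## §1 Difference rows are invariant under reordering the orbitals of either parent -/

section Perm

variable {kA kB : ℕ} {FA FA' : Model kA} {FB FB' : Model kB}

/-- Reordering the orbitals of the FIRST file does not change its difference lower rows. -/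
theorem diffLowerRow_iff_of_perm_left (π : Equiv.Perm (Fin kA)) (hh : ∀ p q, FA'.h p q = FA.h (π p) (π q))
    (heri : ∀ p q r s, FA'.eri p q r s = FA.eri (π p) (π q) (π r) (π s)) (hcore : FA'.ecore = FA.ecore)
    {a b a' b' : ℕ} {lo : ℚ} : DiffLowerRow FA' a b FB a' b' lo ↔ DiffLowerRow FA a b FB a' b' lo := by
  unfold DiffLowerRow
  rw [Model.energy_eq_of_perm π hh heri hcore]

/-- Reordering the orbitals of the FIRST file does not change its difference upper rows. -/
theorem diffUpperRow_iff_of_perm_left (π : Equiv.Perm (Fin kA)) (hh : ∀ p q, FA'.h p q = FA.h (π p) (π q))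
    (heri : ∀ p q r s, FA'.eri p q r s = FA.eri (π p) (π q) (π r) (π s)) (hcore : FA'.ecore = FA.ecore)
    {a b a' b' : ℕ} {hi : ℚ} : DiffUpperRow FA' a b FB a' b' hi ↔ DiffUpperRow FA a b FB a' b' hi := by
  unfold DiffUpperRow
  rw [Model.energy_eq_of_perm π hh heri hcore]

/-- Reordering the orbitals of the FIRST file does not change its difference brackets. -/
theorem diffBracket_iff_of_perm_left (π : Equiv.Perm (Fin kA)) (hh : ∀ p q, FA'.h p q = FA.h (π p) (π q))
    (heri : ∀ p q r s, FA'.eri p q r s = FA.eri (π p) (π q) (π r) (π s)) (hcore : FA'.ecore = FA.ecore)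
    {a b a' b' : ℕ} {lo hi : ℚ} :
    DiffBracket FA' a b FB a' b' lo hi ↔ DiffBracket FA a b FB a' b' lo hi := by
  unfold DiffBracket
  rw [diffLowerRow_iff_of_perm_left π hh heri hcore, diffUpperRow_iff_of_perm_left π hh heri hcore]

/-- Reordering the orbitals of the SECOND file does not change the difference lower rows. -/
theorem diffLowerRow_iff_of_perm_right (π : Equiv.Perm (Fin kB)) (hh : ∀ p q, FB'.h p q = FB.h (π p) (π q))
    (heri : ∀ p q r s, FB'.eri p q r s = FB.eri (π p) (π q) (π r) (π s)) (hcore : FB'.ecore = FB.ecore)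
    {a b a' b' : ℕ} {lo : ℚ} : DiffLowerRow FA a b FB' a' b' lo ↔ DiffLowerRow FA a b FB a' b' lo := by
  unfold DiffLowerRow
  rw [Model.energy_eq_of_perm π hh heri hcore]

/-- Reordering the orbitals of the SECOND file does not change the difference upper rows. -/
theorem diffUpperRow_iff_of_perm_right (π : Equiv.Perm (Fin kB)) (hh : ∀ p q, FB'.h p q = FB.h (π p) (π q))
    (heri : ∀ p q r s, FB'.eri p q r s = FB.eri (π p) (π q) (π r) (π s)) (hcore : FB'.ecore = FB.ecore)
    {a b a' b' : ℕ} {hi : ℚ} : DiffUpperRow FA a b FB' a' b' hi ↔ DiffUpperRow FA a b FB a' b' hi := by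
  unfold DiffUpperRow
  rw [Model.energy_eq_of_perm π hh heri hcore]

/-- Reordering the orbitals of the SECOND file does not change the difference brackets. -/
theorem diffBracket_iff_of_perm_right (π : Equiv.Perm (Fin kB)) (hh : ∀ p q, FB'.h p q = FB.h (π p) (π q))
    (heri : ∀ p q r s, FB'.eri p q r s = FB.eri (π p) (π q) (π r) (π s)) (hcore : FB'.ecore = FB.ecore)
    {a b a' b' : ℕ} {lo hi : ℚ} :
    DiffBracket FA a b FB' a' b' lo hi ↔ DiffBracket FA a b FB a' b' lo hi := by
  unfold DiffBracket
  rw [diffLowerRow_iff_of_perm_right π hh heri hcore, diffUpperRow_iff_of_perm_right π hh heri hcore]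

end Perm

/-! ## §2 `dE-direct:d` from pencil files built on an orbital-ALIGNED parent `P(F_A)` (R-A6) -/

section Aligned

variable {k : ℕ} {FA FA' FB : Model k} (π : Equiv.Perm (Fin k))

/-- **`dE-direct:d`, LOWER side, aligned parent.** `F_A′` is `F_A` with orbitals reordered by `π`
(`hh`, `heri`, `hcore`); a FORMAT-qcl1 lower certificate for the combined file `c·F_A′ − F_B` (`c ≥ 1`)
and a FORMAT-qcu0 upper certificate for `F_A` (in its OWN order; use `upperCertificate_of_perm` first
if it was issued for `F_A′`), both in sector `(a, b)` with `a, b ≤ k`, give the difference lower row of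
the PINNED pair: `ℓ − (c − 1)·u_A ≤ E₀(A) − E₀(B)`. -/
theorem diffLowerRow_of_alignedPencil_certificates (hh : ∀ p q, FA'.h p q = FA.h (π p) (π q))
    (heri : ∀ p q r s, FA'.eri p q r s = FA.eri (π p) (π q) (π r) (π s)) (hcore : FA'.ecore = FA.ecore)
    (hA : FA.IsSymmetric) (hB : FB.IsSymmetric) {a b : ℕ} (ha : a ≤ k) (hb : b ≤ k) {c ℓ uA : ℚ}
    (hc : 1 ≤ c) (hP : LowerCertificate (Model.lincomb c (-1) FA' FB) a b ℓ)
    (hU : UpperCertificate FA a b uA) : DiffLowerRow FA a b FB a b (ℓ - (c - 1) * uA) := by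
  have hA' : FA'.IsSymmetric := (Model.isSymmetric_iff_of_perm π hh heri).2 hA
  have hU' : UpperRow FA' a b uA :=
    (upperRow_iff_of_perm π hh heri hcore).2 (upperRow_of_certificate hA hU)
  exact (diffLowerRow_iff_of_perm_left π hh heri hcore).1
    (diffLowerRow_of_pencil_of_upperRow hA' hB hc
      (lowerRow_of_certificate (Model.lincomb_isSymmetric hA' hB) ha hb hP) hU')

/-- **`dE-direct:d`, UPPER side, aligned parent.** A FORMAT-qcl1 lower certificate for `c·F_B − F_A′`
(`c ≥ 1`, `F_A′ = F_A` reordered by `π`) and a FORMAT-qcu0 upper certificate for `F_B` give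
`E₀(A) − E₀(B) ≤ (c − 1)·u_B − ℓ` for the PINNED pair. -/
theorem diffUpperRow_of_alignedPencil_certificates (hh : ∀ p q, FA'.h p q = FA.h (π p) (π q))
    (heri : ∀ p q r s, FA'.eri p q r s = FA.eri (π p) (π q) (π r) (π s)) (hcore : FA'.ecore = FA.ecore)
    (hA : FA.IsSymmetric) (hB : FB.IsSymmetric) {a b : ℕ} (ha : a ≤ k) (hb : b ≤ k) {c ℓ uB : ℚ}
    (hc : 1 ≤ c) (hP : LowerCertificate (Model.lincomb c (-1) FB FA') a b ℓ)
    (hU : UpperCertificate FB a b uB) : DiffUpperRow FA a b FB a b ((c - 1) * uB - ℓ) := by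
  have hA' : FA'.IsSymmetric := (Model.isSymmetric_iff_of_perm π hh heri).2 hA
  exact (diffUpperRow_iff_of_perm_left π hh heri hcore).1
    (diffUpperRow_of_pencil_certificates hA' hB ha hb hc hP hU)

/-- **THE TWO-SIDED `dE-direct:d` BRACKET from aligned pencil files** (`K⁺ = c_A·F_A′ − F_B`,
`K⁻ = c_B·F_B − F_A′`, `F_A′ = P(F_A)`): the pinned pair's certified difference bracket
`ℓ_A − (c_A − 1)·u_A ≤ E₀(A) − E₀(B) ≤ (c_B − 1)·u_B − ℓ_B`, at the ROW level (each lower row of a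
combined file from `lowerRow_of_certificate`, each upper row in the parent's own order). -/
theorem diffBracket_of_alignedPencils (hh : ∀ p q, FA'.h p q = FA.h (π p) (π q))
    (heri : ∀ p q r s, FA'.eri p q r s = FA.eri (π p) (π q) (π r) (π s)) (hcore : FA'.ecore = FA.ecore)
    (hA : FA.IsSymmetric) (hB : FB.IsSymmetric) {a b : ℕ} {cA ℓA uA cB ℓB uB : ℚ} (hcA : 1 ≤ cA)
    (hcB : 1 ≤ cB) (hPA : LowerRow (Model.lincomb cA (-1) FA' FB) a b ℓA) (hUA : UpperRow FA a b uA)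
    (hPB : LowerRow (Model.lincomb cB (-1) FB FA') a b ℓB) (hUB : UpperRow FB a b uB) :
    DiffBracket FA a b FB a b (ℓA - (cA - 1) * uA) ((cB - 1) * uB - ℓB) := by
  have hA' : FA'.IsSymmetric := (Model.isSymmetric_iff_of_perm π hh heri).2 hA
  have hUA' : UpperRow FA' a b uA := (upperRow_iff_of_perm π hh heri hcore).2 hUA
  exact (diffBracket_iff_of_perm_left π hh heri hcore).1
    (diffBracket_of_pencils hA' hB hcA hcB hPA hUA' hPB hUB)

end Aligned

end Summit.Ventures.CertifiedQuantumChemistry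

end
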